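import Summits.CriticalPhenomena.CardyFormulaZ2.Theses.CardySelfRefinement
import HarnessLib

/-!
# Lag merging implies the near-identity gain (converse bookkeeping for line `Sketch` of the crux
# `ScaleInvariantLimits`, stmt-CriticalPhenomena-10265)

Line `Sketch` (card "marginal-three-arm-bootstrap") reduces the crux `ScaleInvariantLimits` to
the near-identity gain C⁺ on the lattice orbit (`stub_latticeNearIdentityGain`): for a fixed finite
family of quads `G`, `P(δ) := μ_δ {S | ∀ i, G i ∈ S}` (`μ_δ = squareCrossingLaw univ δ`) moves by
at most `ε τ` between meshes `δ` and `(1 + τ) δ` for all small lags `τ` and all small meshes.  The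
bootstrap `stub_lags_of_nearIdentityGain` (landed) turns C⁺ into lag merging
`P(k η) - P(η) → 0` (`η → 0⁺`) for every `k > 1`.

This file records the (easy) CONVERSE, `stub_nearIdentityGain_of_lags`: lag merging for every
`k > 1` gives C⁺ back — apply merging at the single lag `k = 1 + τ`; the difference tends to `0`,
so it is eventually below the positive number `ε τ`.  Together the two directions show that, at
the level of the lattice laws, C⁺ is EQUIVALENT to asymptotic lag invariance of the joint crossing
probabilities (the crossing-event form of the crux disprover's `AsymptoticLagInvariance`, Disproof
§4): the near-identity reformulation relocates the difficulty of the crux without loss and without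
gain.  Pure real analysis (`nearIdentityGain_of_tendsto_sub`, arbitrary `f : ℝ → ℝ`).
-/

noncomputable section

open MeasureTheory Filter Set Topology
open Literature.Probability.Percolation Literature.Probability.Percolation.QuadCrossing

namespace Summit.CriticalPhenomena.CardyFormulaZ2.Theorems

/-- **Merging at every lag gives the near-identity gain** (real-variable form).  If
`f (k η) - f η → 0` as `η → 0⁺` for every `k > 1`, then for every `ε > 0` and EVERY lag
`0 < τ < 1` there is `δ₀ > 0` with `|f ((1 + τ) δ) - f δ| ≤ ε τ` for `0 < δ < δ₀` (merging at the
lag `1 + τ`, read below the positive level `ε τ`). -/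
theorem nearIdentityGain_of_tendsto_sub (f : ℝ → ℝ)
    (hlags : ∀ k : ℝ, 1 < k → Tendsto (fun η : ℝ => f (k * η) - f η) (𝓝[>] 0) (𝓝 0))
    (ε : ℝ) (hε : 0 < ε) :
    ∃ τ₀ : ℝ, 0 < τ₀ ∧ ∀ τ ∈ Ioo (0 : ℝ) τ₀, ∃ δ₀ : ℝ, 0 < δ₀ ∧ ∀ δ ∈ Ioo (0 : ℝ) δ₀,
      |f ((1 + τ) * δ) - f δ| ≤ ε * τ := by
  refine ⟨1, one_pos, fun τ hτ => ?_⟩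
  have h := hlags (1 + τ) (by linarith [hτ.1])
  rw [Metric.tendsto_nhdsWithin_nhds] at h
  obtain ⟨δ₀, hδ₀, hδ⟩ := h (ε * τ) (mul_pos hε hτ.1)
  refine ⟨δ₀, hδ₀, fun δ hδ' => ?_⟩
  have hdist : dist δ 0 < δ₀ := by
    rw [Real.dist_eq, sub_zero, abs_of_pos hδ'.1]
    exact hδ'.2
  have := hδ hδ'.1 hdist
  rw [Real.dist_eq, sub_zero] at this
  exact this.le

/-- **Lag merging for every `k > 1` implies the near-identity gain C⁺ of line `Sketch`** (the
converse of the landed bootstrap `stub_lags_of_nearIdentityGain`): if for every `k > 1` and every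
finite family of quads `G` the joint crossing probabilities of critical bond-`ℤ²` percolation at
meshes `k η` and `η` merge as `η → 0⁺`, then for every `G` and `ε > 0` there is `τ₀ > 0` (indeed
`τ₀ = 1`) such that for all `0 < τ < τ₀` the joint crossing probability moves by at most `ε τ`
between meshes `δ` and `(1 + τ) δ`, for all small `δ`.  Hence, on the lattice orbit, C⁺ is
equivalent to asymptotic lag invariance of the joint crossing probabilities. -/
theorem stub_nearIdentityGain_of_lags
    (hlags : ∀ k : ℝ, 1 < k → ∀ (m : ℕ) (G : Fin m → Quad (univ : Set ℂ)),
      Tendsto (fun η : ℝ =>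
        (squareCrossingLaw (univ : Set ℂ) (k * η) : Measure (QuadConfig (univ : Set ℂ))).real
            {S | ∀ i, G i ∈ S} -
          (squareCrossingLaw (univ : Set ℂ) η : Measure (QuadConfig (univ : Set ℂ))).real
            {S | ∀ i, G i ∈ S}) (𝓝[>] 0) (𝓝 0))
    (m : ℕ) (G : Fin m → Quad (univ : Set ℂ)) (ε : ℝ) (hε : 0 < ε) :
    ∃ τ₀ : ℝ, 0 < τ₀ ∧ ∀ τ ∈ Ioo (0 : ℝ) τ₀, ∃ δ₀ : ℝ, 0 < δ₀ ∧ ∀ δ ∈ Ioo (0 : ℝ) δ₀,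
      |(squareCrossingLaw (univ : Set ℂ) ((1 + τ) * δ) : Measure (QuadConfig (univ : Set ℂ))).real
          {S | ∀ i, G i ∈ S} -
        (squareCrossingLaw (univ : Set ℂ) δ : Measure (QuadConfig (univ : Set ℂ))).real
          {S | ∀ i, G i ∈ S}| ≤ ε * τ :=
  nearIdentityGain_of_tendsto_sub
    (fun δ => (squareCrossingLaw (univ : Set ℂ) δ : Measure (QuadConfig (univ : Set ℂ))).real
      {S | ∀ i, G i ∈ S})
    (fun k hk => hlags k hk m G) ε hε

end Summit.CriticalPhenomena.CardyFormulaZ2.Theorems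

end
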